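import Summits.Ventures.HSemireg.ContractionSpanDegreeOne
import Summits.Ventures.HSemireg.ContractionSpanTwist
import Mathlib.Algebra.Algebra.Subalgebra.Lattice
import HarnessLib

/-!
# Venture HSemireg — Künneth structure of the polyvector contraction span, I: factor subalgebras `Λ W ⊆ Λ V`,
# their even parts, and the ten product rules (th-7's K_lin, degree ≤ 2, in the LITERAL contraction frame of
# `PerfectComplexRankDoor.lean`)

HONEST FRAMING. Pure linear algebra in the exterior algebra `Λ V`, continuing `ContractionSpanAlgebra.lean` /
`ContractionSpanPointIdeal.lean` / `ContractionSpanDegreeOne.lean` (seat p4 of the computation cell `pub-hsemireg`;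
statement sheet `theory/FORMULA-N-th7.md` §N.3 «THEOREM K_lin» and §N.5 «the p4-carrier bridge», theory seat 7).
Nothing here is a claim about any variety and nothing here says that HC / HC_CM / HC_AV holds. Everything is PROVED;
no named fact.

CONTENT. Inside the single algebra `Λ V`: `factorAlg W` = the subalgebra generated by a subspace `W` (the image of `Λ W → Λ V`),
`evenFactorAlg W` = the subalgebra generated by the `v ∧ w`, `v, w ∈ W` (`= Λ^{even} W`; Chern characters are even), and
`factorForms L W` = the linear forms killing `L` and `W` (a factor's own «vector fields» extended by zero across the other
factor `W`). LEMMAS: a form killing `W` kills `Λ W` (`contractLeft_eq_zero_of_mem_factorAlg`, left induction on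
monomials); `Λ W` is `ι_θ`-stable; even elements are CENTRAL and `ι_θ` is a DERIVATION across them (seat p6's
`commute_ι_mul_ι` / `contractLeft_mul_of_mem_span_ι_mul_ι` for the generators, extended to the generated subalgebra); the
one residual sign `m ∧ ι_θ x = -(ι_θ x ∧ m)` for even `x` is DERIVED from these. Then, for two factors `x₁ ∈ Λ^{even} V₁`,
`x₂ ∈ Λ^{even} V₂`, the TEN PRODUCT RULES (R1)–(R10): a degree-`i` contraction generator of `x₁` times a degree-`j` generator
of `x₂` (`i + j = 2`) is `±` a degree-`2` contraction generator of `x₁ ∧ x₂` — the input of the product formula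
`span(x₁ ∧ x₂) = S²(x₁)·x₂ + S¹(x₁)·S¹(x₂) + x₁·S²(x₂)` proved in the sequel `ContractionSpanKunneth.lean`.

References: [BourbakiAlgebre1a3] Ch. III §7 (exterior algebra; no. 7: `Λ(M ⊕ N)`; even elements central), §11 no. 9
(interior products are antiderivations); [BuchweitzFlenner2008HH] Prop. 6.4.4 (why these operators: `σ_F ∘ c_F = ⌟ ch F`).
-/

noncomputable section

open CliffordAlgebra (contractLeft)
open ExteriorAlgebra (ι)
open Module

namespace Summit.Ventures.HSemireg

namespace ContractionSpan

section Ring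

variable {K : Type*} [CommRing K] {V : Type*} [AddCommGroup V] [Module K V]

/-! ### 1. The factor subalgebra `Λ W ⊆ Λ V`, its even part, and the interior products across them -/

/-- **`Λ W ⊆ Λ V`**: the subalgebra of `Λ V` generated by (the vectors of) a subspace `W` — i.e. the IMAGE of `Λ W → Λ V`
(which is injective when `W` is a direct summand, e.g. over a field; these files only ever use the image subalgebra).
[cite: BourbakiAlgebre1a3, Ch. III §7 no. 7] -/
def factorAlg (W : Submodule K V) : Subalgebra K (ExteriorAlgebra K V) :=
  Algebra.adjoin K (ι K '' (W : Set V))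

/-- **`Λ^{even} W ⊆ Λ V`**: the subalgebra generated by the `v ∧ w`, `v, w ∈ W` (where Chern characters live).
[cite: BourbakiAlgebre1a3, Ch. III §7 no. 7] -/
def evenFactorAlg (W : Submodule K V) : Subalgebra K (ExteriorAlgebra K V) :=
  Algebra.adjoin K {z | ∃ v ∈ W, ∃ w ∈ W, z = ι K v * ι K w}

/-- The linear forms killing `L` and the subspace `W` (a factor's own vector fields, extended by `0` on the other
factor `W`). [cite: BourbakiAlgebre1a3, Ch. III §11 no. 9] -/
def factorForms (L W : Submodule K V) : Set (Module.Dual K V) :=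
  {θ | (∀ q ∈ L, θ q = 0) ∧ ∀ v ∈ W, θ v = 0}

variable {W : Submodule K V}

/-- `ι v ∈ Λ W` for `v ∈ W`. [cite: BourbakiAlgebre1a3, Ch. III §7 no. 7] -/
theorem ι_mem_factorAlg {v : V} (hv : v ∈ W) : ι K v ∈ factorAlg W :=
  Algebra.subset_adjoin ⟨v, hv, rfl⟩

/-- `Λ^{even} W ⊆ Λ W`. [cite: BourbakiAlgebre1a3, Ch. III §7 no. 7] -/
theorem evenFactorAlg_le : evenFactorAlg W ≤ factorAlg W :=
  Algebra.adjoin_le (by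
    rintro z ⟨v, hv, w, hw, rfl⟩
    exact mul_mem (ι_mem_factorAlg hv) (ι_mem_factorAlg hw))

/-- `v ∧ w ∈ Λ^{even} W` for `v, w ∈ W`. [cite: BourbakiAlgebre1a3, Ch. III §7 no. 7] -/
theorem ι_mul_ι_mem_evenFactorAlg {v w : V} (hv : v ∈ W) (hw : w ∈ W) : ι K v * ι K w ∈ evenFactorAlg W :=
  Algebra.subset_adjoin ⟨v, hv, w, hw, rfl⟩

/-- **Left induction on `Λ W`**: a `K`-linear property stable under `y ↦ v ∧ y` (`v ∈ W`) and true at `1` holds on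
`Λ W` (`Λ W` is spanned by the monomials `v₁ ∧ ⋯ ∧ v_k`, `vᵢ ∈ W`). [cite: BourbakiAlgebre1a3, Ch. III §7 no. 7] -/
theorem factorAlg_induction {p : ExteriorAlgebra K V → Prop} (h1 : p 1)
    (hmul : ∀ v ∈ W, ∀ y ∈ factorAlg W, p y → p (ι K v * y))
    (h0 : p 0) (hadd : ∀ y z, p y → p z → p (y + z)) (hsmul : ∀ (c : K) y, p y → p (c • y))
    {x : ExteriorAlgebra K V} (hx : x ∈ factorAlg W) : p x := by
  have hx' : x ∈ Subalgebra.toSubmodule (factorAlg W) := hx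
  clear hx
  rw [factorAlg, Algebra.adjoin_eq_span] at hx'
  induction hx' using Submodule.span_induction with
  | mem m hm =>
    induction hm using Submonoid.closure_induction_left with
    | one => exact h1
    | mul_left z hz y hy ih =>
      obtain ⟨v, hv, rfl⟩ := hz
      have hy' : y ∈ factorAlg W := by
        have h := Submodule.subset_span (R := K) hy
        rwa [← Algebra.adjoin_eq_span] at h
      exact hmul v hv y hy' ih
  | zero => exact h0
  | add y z _ _ hy hz => exact hadd y z hy hz
  | smul c y _ hy => exact hsmul c y hy

/-- **A form killing `W` kills `Λ W`**: `ι_θ y = 0` for `y ∈ Λ W` when `θ|_W = 0`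
(`ι_θ (v ∧ y) = θ(v)·y - v ∧ ι_θ y`). [cite: BourbakiAlgebre1a3, Ch. III §11 no. 9] -/
theorem contractLeft_eq_zero_of_mem_factorAlg {θ : Module.Dual K V} (hθ : ∀ v ∈ W, θ v = 0)
    {y : ExteriorAlgebra K V} (hy : y ∈ factorAlg W) : contractLeft θ y = 0 := by
  refine factorAlg_induction (p := fun y => contractLeft θ y = 0) (CliffordAlgebra.contractLeft_one _ θ) ?_
    (map_zero _) (fun y z hy hz => by rw [map_add, hy, hz, add_zero]) (fun c y hy => by rw [map_smul, hy, smul_zero]) hy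
  intro v hv y _ ih
  rw [CliffordAlgebra.contractLeft_ι_mul, hθ v hv, zero_smul, ih, mul_zero, sub_zero]

/-- `Λ W` is stable under every interior product `ι_θ`. [cite: BourbakiAlgebre1a3, Ch. III §11 no. 9] -/
theorem contractLeft_mem_factorAlg (θ : Module.Dual K V) {y : ExteriorAlgebra K V} (hy : y ∈ factorAlg W) :
    contractLeft θ y ∈ factorAlg W := by
  refine factorAlg_induction (p := fun y => contractLeft θ y ∈ factorAlg W) ?_ ?_ ?_ ?_ ?_ hy
  · rw [CliffordAlgebra.contractLeft_one]; exact Subalgebra.zero_mem _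
  · intro v hv y hy ih
    rw [CliffordAlgebra.contractLeft_ι_mul]
    exact Subalgebra.sub_mem _ (Subalgebra.smul_mem _ hy _) (Subalgebra.mul_mem _ (ι_mem_factorAlg hv) ih)
  · rw [map_zero]; exact Subalgebra.zero_mem _
  · intro y z hy hz; rw [map_add]; exact Subalgebra.add_mem _ hy hz
  · intro c y hy; rw [map_smul]; exact Subalgebra.smul_mem _ hy c

/-- **Even elements are central**: `x ∈ Λ^{even} W` commutes with everything (seat p6's `commute_ι_mul_ι` for the
generators `v ∧ w`). [cite: BourbakiAlgebre1a3, Ch. III §7] -/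
theorem commute_of_mem_evenFactorAlg {x : ExteriorAlgebra K V} (hx : x ∈ evenFactorAlg W) (z : ExteriorAlgebra K V) :
    Commute x z := by
  have hle : evenFactorAlg W ≤ Subalgebra.center K (ExteriorAlgebra K V) :=
    Algebra.adjoin_le (by
      rintro y ⟨v, -, w, -, rfl⟩
      exact Subalgebra.mem_center_iff.mpr fun b => (commute_ι_mul_ι v w b).eq.symm)
  exact (Subalgebra.mem_center_iff.mp (hle hx) z).symm

/-- **`ι_θ` is a derivation across even elements**: `ι_θ (x ∧ z) = ι_θ x ∧ z + x ∧ ι_θ z` for `x ∈ Λ^{even} W`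
(the antiderivation sign `(-1)^{deg x}` is `+1`; seat p6's lemma for the generators, extended multiplicatively).
[cite: BourbakiAlgebre1a3, Ch. III §11 no. 9] -/
theorem contractLeft_mul_of_mem_evenFactorAlg (θ : Module.Dual K V) {x : ExteriorAlgebra K V}
    (hx : x ∈ evenFactorAlg W) (z : ExteriorAlgebra K V) :
    contractLeft θ (x * z) = contractLeft θ x * z + x * contractLeft θ z := by
  induction hx using Algebra.adjoin_induction generalizing z with
  | mem y hy =>
    obtain ⟨v, -, w, -, rfl⟩ := hy
    exact contractLeft_mul_of_mem_span_ι_mul_ι θ (Submodule.subset_span ⟨v, w, rfl⟩) z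
  | algebraMap r =>
    rw [CliffordAlgebra.contractLeft_algebraMap_mul, CliffordAlgebra.contractLeft_algebraMap, zero_mul, zero_add]
  | add y y' _ _ hy hy' => rw [add_mul, map_add, hy, hy', map_add, add_mul, add_mul]; abel
  | mul y y' _ _ hy hy' =>
    rw [mul_assoc, hy, hy', hy]
    simp only [mul_add, add_mul, mul_assoc]
    abel

/-- The residual sign, derived: `m ∧ ι_θ x = -(ι_θ x ∧ m)` for EVEN `x` (`ι_θ x` is odd).
[cite: BourbakiAlgebre1a3, Ch. III §11 no. 9] -/
theorem ι_mul_contractLeft_of_mem_evenFactorAlg {x : ExteriorAlgebra K V} (hx : x ∈ evenFactorAlg W)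
    (θ : Module.Dual K V) (m : V) : ι K m * contractLeft θ x = -(contractLeft θ x * ι K m) := by
  have hc : ι K m * x = x * ι K m := ((commute_of_mem_evenFactorAlg hx) (ι K m)).eq.symm
  have h1 := CliffordAlgebra.contractLeft_ι_mul θ m x
  rw [hc, contractLeft_mul_of_mem_evenFactorAlg θ hx, CliffordAlgebra.contractLeft_ι, ← Algebra.commutes,
    ← Algebra.smul_def] at h1
  calc ι K m * contractLeft θ x = θ m • x - (θ m • x - ι K m * contractLeft θ x) := by abel
    _ = θ m • x - (contractLeft θ x * ι K m + θ m • x) := by rw [h1]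
    _ = -(contractLeft θ x * ι K m) := by abel

/-- `a ∧ b = -(b ∧ a)` for vectors. [cite: BourbakiAlgebre1a3, Ch. III §7] -/
theorem ι_mul_ι_eq_neg (a b : V) : ι K a * ι K b = -(ι K b * ι K a) :=
  eq_neg_of_add_eq_zero_left (ExteriorAlgebra.ι_add_mul_swap a b)

/-- `a ∧ (b ∧ z) = -(b ∧ (a ∧ z))`. [cite: BourbakiAlgebre1a3, Ch. III §7] -/
theorem ι_mul_ι_mul_eq_neg (a b : V) (z : ExteriorAlgebra K V) : ι K a * (ι K b * z) = -(ι K b * (ι K a * z)) := by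
  rw [← mul_assoc, ι_mul_ι_eq_neg a b, neg_mul, mul_assoc]

/-! ### 2. Two factors: the ten product rules (a generator of a factor span times a generator of the other
factor's span is, up to sign, a generator of the product's span) -/

section Product

variable {V₁ V₂ : Submodule K V} {x₁ x₂ : ExteriorAlgebra K V}

/-- `ι_θ (x₁ ∧ x₂) = ι_θ x₁ ∧ x₂` when `θ` kills `V₂ ∋ x₂` and `x₁` is even. [cite: BourbakiAlgebre1a3, Ch. III §11 no. 9] -/
theorem contractLeft_mul_eq_left (hx₁ : x₁ ∈ evenFactorAlg V₁) (hx₂ : x₂ ∈ factorAlg V₂) {θ : Module.Dual K V}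
    (hθ : ∀ v ∈ V₂, θ v = 0) : contractLeft θ (x₁ * x₂) = contractLeft θ x₁ * x₂ := by
  rw [contractLeft_mul_of_mem_evenFactorAlg θ hx₁, contractLeft_eq_zero_of_mem_factorAlg hθ hx₂, mul_zero, add_zero]

/-- `ι_θ (x₁ ∧ x₂) = x₁ ∧ ι_θ x₂` when `θ` kills `V₁ ∋ x₁`, `x₁` even. [cite: BourbakiAlgebre1a3, Ch. III §11 no. 9] -/
theorem contractLeft_mul_eq_right (hx₁ : x₁ ∈ evenFactorAlg V₁) {θ : Module.Dual K V} (hθ : ∀ v ∈ V₁, θ v = 0) :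
    contractLeft θ (x₁ * x₂) = x₁ * contractLeft θ x₂ := by
  rw [contractLeft_mul_of_mem_evenFactorAlg θ hx₁, contractLeft_eq_zero_of_mem_factorAlg hθ (evenFactorAlg_le hx₁),
    zero_mul, zero_add]

/-- (R1) `(q ∧ q' ∧ x₁) ∧ x₂ = q ∧ q' ∧ (x₁ ∧ x₂)`. [cite: BourbakiAlgebre1a3, Ch. III §7] -/
theorem wedge₂_mul (q q' : V) : ι K q * (ι K q' * x₁) * x₂ = ι K q * (ι K q' * (x₁ * x₂)) := by
  simp only [mul_assoc]

/-- (R2) `(q ∧ ι_θ x₁) ∧ x₂ = q ∧ ι_θ (x₁ ∧ x₂)` for `θ` killing `V₂`. [cite: BourbakiAlgebre1a3, Ch. III §11 no. 9] -/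
theorem mixed_mul (hx₁ : x₁ ∈ evenFactorAlg V₁) (hx₂ : x₂ ∈ evenFactorAlg V₂) (q : V) {θ : Module.Dual K V}
    (hθ : ∀ v ∈ V₂, θ v = 0) : ι K q * contractLeft θ x₁ * x₂ = ι K q * contractLeft θ (x₁ * x₂) := by
  rw [mul_assoc, contractLeft_mul_eq_left hx₁ (evenFactorAlg_le hx₂) hθ]

/-- (R3) `(ι_θ ι_{θ'} x₁) ∧ x₂ = ι_θ ι_{θ'} (x₁ ∧ x₂)` for `θ, θ'` killing `V₂`.
[cite: BourbakiAlgebre1a3, Ch. III §11 no. 9] -/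
theorem contract₂_mul (hx₁ : x₁ ∈ evenFactorAlg V₁) (hx₂ : x₂ ∈ evenFactorAlg V₂) {θ θ' : Module.Dual K V}
    (hθ : ∀ v ∈ V₂, θ v = 0) (hθ' : ∀ v ∈ V₂, θ' v = 0) :
    contractLeft θ (contractLeft θ' x₁) * x₂ = contractLeft θ (contractLeft θ' (x₁ * x₂)) := by
  rw [contractLeft_mul_eq_left hx₁ (evenFactorAlg_le hx₂) hθ',
    ← (commute_of_mem_evenFactorAlg hx₂ (contractLeft θ' x₁)).eq, contractLeft_mul_of_mem_evenFactorAlg θ hx₂,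
    contractLeft_eq_zero_of_mem_factorAlg hθ (evenFactorAlg_le hx₂), zero_mul, zero_add,
    (commute_of_mem_evenFactorAlg hx₂ (contractLeft θ (contractLeft θ' x₁))).eq]

/-- (R4) `(q₁ ∧ x₁) ∧ (q₂ ∧ x₂) = q₁ ∧ q₂ ∧ (x₁ ∧ x₂)` (`x₁` even). [cite: BourbakiAlgebre1a3, Ch. III §7] -/
theorem wedge₁_mul_wedge₁ (hx₁ : x₁ ∈ evenFactorAlg V₁) (q₁ q₂ : V) :
    ι K q₁ * x₁ * (ι K q₂ * x₂) = ι K q₁ * (ι K q₂ * (x₁ * x₂)) := by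
  rw [mul_assoc, ← mul_assoc x₁ (ι K q₂) x₂, (commute_of_mem_evenFactorAlg hx₁ (ι K q₂)).eq, mul_assoc]

/-- (R5) `(q₁ ∧ x₁) ∧ ι_{θ₂} x₂ = q₁ ∧ ι_{θ₂} (x₁ ∧ x₂)` for `θ₂` killing `V₁`.
[cite: BourbakiAlgebre1a3, Ch. III §11 no. 9] -/
theorem wedge₁_mul_contract₁ (hx₁ : x₁ ∈ evenFactorAlg V₁) (q₁ : V) {θ₂ : Module.Dual K V}
    (hθ₂ : ∀ v ∈ V₁, θ₂ v = 0) : ι K q₁ * x₁ * contractLeft θ₂ x₂ = ι K q₁ * contractLeft θ₂ (x₁ * x₂) := by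
  rw [contractLeft_mul_eq_right hx₁ hθ₂, mul_assoc]

/-- (R6) `ι_{θ₁} x₁ ∧ (q₂ ∧ x₂) = -(q₂ ∧ ι_{θ₁} (x₁ ∧ x₂))` for `θ₁` killing `V₂` (the one residual sign: `ι_{θ₁} x₁`
is odd). [cite: BourbakiAlgebre1a3, Ch. III §11 no. 9] -/
theorem contract₁_mul_wedge₁ (hx₁ : x₁ ∈ evenFactorAlg V₁) (hx₂ : x₂ ∈ evenFactorAlg V₂) {θ₁ : Module.Dual K V}
    (hθ₁ : ∀ v ∈ V₂, θ₁ v = 0) (q₂ : V) :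
    contractLeft θ₁ x₁ * (ι K q₂ * x₂) = -(ι K q₂ * contractLeft θ₁ (x₁ * x₂)) := by
  rw [contractLeft_mul_eq_left hx₁ (evenFactorAlg_le hx₂) hθ₁, ← mul_assoc (ι K q₂),
    ι_mul_contractLeft_of_mem_evenFactorAlg hx₁, neg_mul, neg_neg, mul_assoc]

/-- (R7) `ι_{θ₁} x₁ ∧ ι_{θ₂} x₂ = ι_{θ₁} ι_{θ₂} (x₁ ∧ x₂)` for `θ₁` killing `V₂` and `θ₂` killing `V₁`.
[cite: BourbakiAlgebre1a3, Ch. III §11 no. 9] -/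
theorem contract₁_mul_contract₁ (hx₁ : x₁ ∈ evenFactorAlg V₁) (hx₂ : x₂ ∈ evenFactorAlg V₂) {θ₁ θ₂ : Module.Dual K V}
    (hθ₁ : ∀ v ∈ V₂, θ₁ v = 0) (hθ₂ : ∀ v ∈ V₁, θ₂ v = 0) :
    contractLeft θ₁ x₁ * contractLeft θ₂ x₂ = contractLeft θ₁ (contractLeft θ₂ (x₁ * x₂)) := by
  rw [contractLeft_mul_eq_right hx₁ hθ₂, contractLeft_mul_of_mem_evenFactorAlg θ₁ hx₁,
    contractLeft_eq_zero_of_mem_factorAlg hθ₁ (contractLeft_mem_factorAlg θ₂ (evenFactorAlg_le hx₂)), mul_zero,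
    add_zero]

/-- (R8) `x₁ ∧ (q ∧ q' ∧ x₂) = q ∧ q' ∧ (x₁ ∧ x₂)` (`x₁` even). [cite: BourbakiAlgebre1a3, Ch. III §7] -/
theorem mul_wedge₂ (hx₁ : x₁ ∈ evenFactorAlg V₁) (q q' : V) :
    x₁ * (ι K q * (ι K q' * x₂)) = ι K q * (ι K q' * (x₁ * x₂)) := by
  rw [← mul_assoc (ι K q) (ι K q') x₂, ← mul_assoc x₁, (commute_of_mem_evenFactorAlg hx₁ _).eq]
  simp only [mul_assoc]

/-- (R9) `x₁ ∧ (q ∧ ι_θ x₂) = q ∧ ι_θ (x₁ ∧ x₂)` for `θ` killing `V₁`. [cite: BourbakiAlgebre1a3, Ch. III §11 no. 9] -/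
theorem mul_mixed (hx₁ : x₁ ∈ evenFactorAlg V₁) (q : V) {θ : Module.Dual K V} (hθ : ∀ v ∈ V₁, θ v = 0) :
    x₁ * (ι K q * contractLeft θ x₂) = ι K q * contractLeft θ (x₁ * x₂) := by
  rw [contractLeft_mul_eq_right hx₁ hθ, ← mul_assoc, ← mul_assoc, (commute_of_mem_evenFactorAlg hx₁ (ι K q)).eq]

/-- (R10) `x₁ ∧ ι_θ ι_{θ'} x₂ = ι_θ ι_{θ'} (x₁ ∧ x₂)` for `θ, θ'` killing `V₁`.
[cite: BourbakiAlgebre1a3, Ch. III §11 no. 9] -/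
theorem mul_contract₂ (hx₁ : x₁ ∈ evenFactorAlg V₁) {θ θ' : Module.Dual K V} (hθ : ∀ v ∈ V₁, θ v = 0)
    (hθ' : ∀ v ∈ V₁, θ' v = 0) :
    x₁ * contractLeft θ (contractLeft θ' x₂) = contractLeft θ (contractLeft θ' (x₁ * x₂)) := by
  rw [contractLeft_mul_eq_right hx₁ hθ', contractLeft_mul_of_mem_evenFactorAlg θ hx₁,
    contractLeft_eq_zero_of_mem_factorAlg hθ (evenFactorAlg_le hx₁), zero_mul, zero_add]

end Product

end Ring

end ContractionSpan

end Summit.Ventures.HSemireg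

end
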